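import Summits.QuantumFields.YangMills.Theorems.ParabolicTrajectoryContinuumLimitOnTrajectoryUvbOfUuvb

/-!
# Route `ParabolicTrajectory`, crux `ContinuumLimitOnTrajectory` (stmt-QuantumFields-10522): vocabulary of line `two-orbit-synchronisation`, part D (reshape v3.4, seat c3)

Fourth route-posited vocabulary file of the line (lead `prover-line-stmt-QuantumFields-10522-c3-0`, seat c3; same
namespace as `…Defs`/`…DefsB`/`…DefsC`). Skeleton v3.3 (seat c2) is closed modulo three `sorry`s: the PROMOTED chart and
the two INPUT stubs `stub_irInputs : IRInputs`, `stub_uvInputs : UVInputs` (`…DefsC` §4). v3.4 reshapes the two inputs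
into statements that can be promoted / filed one by one, changing NO mathematical content:
* §1 `VolumeClause` — the QUARANTINED first conjunct of `IRInputs` on its own: the crux's hypothesis block ⇒
  `PolyVolumeGrowth sch`. It is the misstatement of (A) as typed (torus-seam report
  `Cruxes/ContinuumLimitOnTrajectory/SEAM-two-orbit-synchronisation.md`: the block admits arbitrarily slow volume growth)
  and becomes trivial once the planner adds the clause to (A); it is NOT physics and must not be promoted as an item.
* §1 `IRPhysics` — the remaining conjuncts of `IRInputs`, with the volume clause available as a hypothesis: the rate-free
  finite-size clause `QualFiniteSize` and a torus OS gap `TorusOSGap r sch Δ'` (crux (B)'s currency) — the IR input every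
  (A) line owes.
* §1 `UVPhysics` — `UVInputs` without its redundant conjunct `UVB` (the glue `uvb_of_uuvb` landed, p123609): uniform-threshold
  plaquette-string bounds `UUVB`, rotation restoration `AsympRot`, non-degeneracy `ND2`, `ND3` — the UV input every (A)
  line owes.
* §2 glue (proved): `irInputs_of : VolumeClause → IRPhysics → IRInputs`, `uvInputs_of : UVPhysics → UVInputs` — so the
  v3.3 composition `stubsImplyCrux` is reused verbatim by v3.4.
NOTHING in §1 is asserted. Refs: line card `Lines/two-orbit-synchronisation.md`; `…DefsC`; review note 2 on p108252.
-/

set_option autoImplicit false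

open scoped SchwartzMap
open MeasureTheory Filter Topology
open Literature.MathematicalPhysics.QuantumFieldTheory Literature.MathematicalPhysics.QuantumLattice
open Literature.MathematicalPhysics.AQFT Literature.Probability.LatticeModels
open Summit.QuantumFields.YangMills.Theses.ParabolicTrajectory
open Summit.QuantumFields.YangMills.Cruxes.LatticeGapOnTrajectory.OrbitKantorovichFiniteSize.Transfer (TorusOSGap)

noncomputable section

namespace Summit.QuantumFields.YangMills.Cruxes.ContinuumLimitOnTrajectory.TwoOrbitSynchronisation

/-! ## §1 The v3.4 input statements -/

/-- **Stub statement — VOLUME CLAUSE (quarantined; the misstatement of (A) as typed, NOT a physics input).** Along every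
sequence of the crux's hypothesis block the physical torus half-side grows at least like a power of the inverse spacing,
`PolyVolumeGrowth sch`. Not derivable from the block (its only volume clause is `a_k L_k → ∞`); trivial once (A) carries
the clause. Kept as a separate registered stub so that the two physics inputs below are clean. -/
def VolumeClause : Prop :=
  ∀ (G : Type) [Group G] [TopologicalSpace G] [IsTopologicalGroup G] [CompactSpace G]
    [MeasurableSpace G] [BorelSpace G], IsCompactSimpleLieGroup G →
    ∀ (r : LatticeRep G) (M : ℕ) (θ Δ : ℝ) (sch : SpeciesScheme (YMSpecies G)) (n : ℕ → ℕ),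
    0 < θ → 0 < Δ → (∀ k, sch.a k = ((M : ℝ) ^ n k)⁻¹) → Tendsto sch.β atTop atTop →
    (∀ t : ℕ, 0 < t → ∃ c : ℝ, Tendsto (fun k => ((M : ℝ) ^ n k) ^ 8 *
      latticeConnectedCorr r.ρ (sch.β k) (sch.side k) r.curvature.F r.curvature.F (t * M ^ n k))
        atTop (𝓝 c)) →
    Tendsto (fun k => ((M : ℝ) ^ n k) ^ 8 *
      latticeConnectedCorr r.ρ (sch.β k) (sch.side k) r.curvature.F r.curvature.F (M ^ n k))
        atTop (𝓝 θ) →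
    HasLatticeMassGap r sch Δ → PolyVolumeGrowth sch

/-- **Stub statement — IR PHYSICS (open input; crux (B)'s deliverables in sharp currency).** Along every sequence of the
crux's hypothesis block with polynomial volume growth: the rate-free finite-size clause `QualFiniteSize r M sch n`
(thermodynamic limit at scale) and a torus OS gap `TorusOSGap r sch Δ'` for some `Δ' > 0` (the statement that also feeds
(B)'s transfer clause, `transferHalf_of_torusOSGap`). -/
def IRPhysics : Prop :=
  ∀ (G : Type) [Group G] [TopologicalSpace G] [IsTopologicalGroup G] [CompactSpace G]
    [MeasurableSpace G] [BorelSpace G], IsCompactSimpleLieGroup G →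
    ∀ (r : LatticeRep G) (M : ℕ) (θ Δ : ℝ) (sch : SpeciesScheme (YMSpecies G)) (n : ℕ → ℕ),
    0 < θ → 0 < Δ → (∀ k, sch.a k = ((M : ℝ) ^ n k)⁻¹) → Tendsto sch.β atTop atTop →
    (∀ t : ℕ, 0 < t → ∃ c : ℝ, Tendsto (fun k => ((M : ℝ) ^ n k) ^ 8 *
      latticeConnectedCorr r.ρ (sch.β k) (sch.side k) r.curvature.F r.curvature.F (t * M ^ n k))
        atTop (𝓝 c)) →
    Tendsto (fun k => ((M : ℝ) ^ n k) ^ 8 *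
      latticeConnectedCorr r.ρ (sch.β k) (sch.side k) r.curvature.F r.curvature.F (M ^ n k))
        atTop (𝓝 θ) →
    HasLatticeMassGap r sch Δ → PolyVolumeGrowth sch →
      QualFiniteSize r M sch n ∧ ∃ Δ' : ℝ, 0 < Δ' ∧ TorusOSGap r sch Δ'

/-- **Stub statement — UV PHYSICS (open input).** Along a crux-admissible sequence with polynomial volume growth whose
canonical curvature functions converge on products: uniform-threshold plaquette-string bounds `UUVB`, rotation
restoration `AsympRot`, and the two non-degeneracy witnesses `ND2`, `ND3`. (`UVInputs` without `UVB`, which follows from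
`UUVB` by the landed glue `uvb_of_uuvb`.) -/
def UVPhysics : Prop :=
  ∀ (G : Type) [Group G] [TopologicalSpace G] [IsTopologicalGroup G] [CompactSpace G]
    [MeasurableSpace G] [BorelSpace G], IsCompactSimpleLieGroup G →
    ∀ (r : LatticeRep G) (M : ℕ) (θ Δ : ℝ) (sch : SpeciesScheme (YMSpecies G)) (n : ℕ → ℕ),
    0 < θ → 0 < Δ → (∀ k, sch.a k = ((M : ℝ) ^ n k)⁻¹) → Tendsto sch.β atTop atTop →
    (∀ t : ℕ, 0 < t → ∃ c : ℝ, Tendsto (fun k => ((M : ℝ) ^ n k) ^ 8 *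
      latticeConnectedCorr r.ρ (sch.β k) (sch.side k) r.curvature.F r.curvature.F (t * M ^ n k))
        atTop (𝓝 c)) →
    Tendsto (fun k => ((M : ℝ) ^ n k) ^ 8 *
      latticeConnectedCorr r.ρ (sch.β k) (sch.side k) r.curvature.F r.curvature.F (M ^ n k))
        atTop (𝓝 θ) →
    HasLatticeMassGap r sch Δ → PolyVolumeGrowth sch → ConvProducts r sch →
      UUVB r sch ∧ AsympRot r sch ∧ ND2 r sch ∧ ND3 r sch

/-! ## §2 Glue (proved): the v3.3 inputs from the v3.4 inputs -/

/-- `IRInputs` (v3.3) from the volume clause and the IR physics input (v3.4). -/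
theorem irInputs_of : VolumeClause → IRPhysics → IRInputs := by
  intro hvol hir G _ _ _ _ _ _ hG r M θ Δ sch n hθ hΔ hshape hβ htower htune hgap
  have hgrowth := hvol G hG r M θ Δ sch n hθ hΔ hshape hβ htower htune hgap
  exact ⟨hgrowth, hir G hG r M θ Δ sch n hθ hΔ hshape hβ htower htune hgap hgrowth⟩

/-- `UVInputs` (v3.3) from the UV physics input (v3.4): `UVB` by `uvb_of_uuvb`. -/
theorem uvInputs_of : UVPhysics → UVInputs := by
  intro huv G _ _ _ _ _ _ hG r M θ Δ sch n hθ hΔ hshape hβ htower htune hgap hgrowth hconv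
  obtain ⟨hUUVB, hRot, hND2, hND3⟩ := huv G hG r M θ Δ sch n hθ hΔ hshape hβ htower htune hgap hgrowth hconv
  exact ⟨hUUVB, uvb_of_uuvb r sch hUUVB, hRot, hND2, hND3⟩

end Summit.QuantumFields.YangMills.Cruxes.ContinuumLimitOnTrajectory.TwoOrbitSynchronisation

end
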